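import Literature.MathematicalPhysics.QuantumFieldTheory.Balaban1983to89.B9Thm33GlobalBlockWitnessCubeZd

/-!
# `Balaban1983to89.B9SupplySockB9P3ZdCubeUniform` — [Balaban1985BackgroundPropagators] Thm 3.3 p. 399 ∕ Thm 3.11 p. 416 FOR THE CUBE ROAD OF
# [Balaban1985RegularSpaces] (1.131), IN THE DATUM'S CURRENCY: the node N06's input to the junction J-N06→N05 at the cube family, REDUCED TO TWO
# MEMBER-UNIFORM STATEMENTS on the genuine record — `InvAtHICubeUniform` ((3.27) with ONE threshold for every cube member = Thm 3.11's uniform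
# `α₀′`) and `GlobAtICubeUniform` ((3.47) entries 0, 1, 3 at `γ = −3` with ONE `B₀` for every cube member = Thm 3.3's uniform constant) — and the
# β collar socket of (1.59) with MEMBER-UNIFORM constants from them

statement-level skeleton of published theorems with citation tags; proofs where landed; nothing here is a claim about the
Yang–Mills mass gap

`[Balaban1985BackgroundPropagators]` ("B9", CMP **99** (1985) 389–434; journal page = PDF page + 388): Thm 3.3 p. 399 («There exist constants … depending on
d and L only»), (3.47) p. 398, Thm 3.11 p. 416 («there exist constants M₀, α₀′ such that …»), (3.27) p. 395.  `[Balaban1985RegularSpaces]` ("B8", CMP **99**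
(1985) 75–102): (1.58)–(1.59) p. 86, (1.131) p. 99 (the cube family `{□_j}`), Thm 4 p. 88, (1.7) p. 77, (1.33) p. 82.  `[Balaban1984PropagatorsII]` (2.3) p. 224.

CITATION HEADER ∕ WHY THIS FILE (cell `pub-ymgap`, HUMAN RULING D-0062; seat `pub-ymgap-dag-n06-b` (g20), binder∕letter owner of the junction J-N06→N05).
LOCATED-SELF-6∕7 (g20): at the cube members of (1.131) with `Ω₀ = □₀` finite (`cubeFam false`), every FRAME-keyed statement about the genuine `G_𝔤(U₀)`
quantified over the class (3.35) of the `ℤᵈ` frame (`bgZd.Reg335`) — `InvAtH`, `PosDefInClassAtH`, and Thm 3.3's block as `B9.Thm33Printed … (GAZdFam …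
(withGopZdH (opsAllZd …)) …)` over any index containing such members — is UNSATISFIABLE (the class leaves the collar plaquettes free; `Δ_a(U₀)` is indefinite
there).  So the cube road's N06 input cannot be «Thm 3.3 ∕ Thm 3.11 AS A FRAME STATEMENT»; print's own usage ([B8] (1.33): «U₀ ∈ 𝔄_k({Ω_j}, α₀)») is the
DATUM's class.  THIS FILE names the two statements the cube road actually needs from N06, in that currency and with constants UNIFORM over the cube family
(print: «depending on d and L only», «M₀, α₀′»): `InvAtHICubeUniform τ L ops₀ aI` and `GlobAtICubeUniform τ L ops₀ aT B₀`; and proves (§2) that they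
give the β collar socket `SockB9P3D4β` at EVERY cube member with ONE `(B₀′, B_∂, cP)` (the other three binders of the frame-free supplier
`B9SupplySockB9P3ZdDatum.sockB9P3D4βU_at` are member-free theorems: `CurvAtInAk` with `c₆₉ = 14(d−1)`, `LandauAtU`, `AvgAtγ` with `q = qQ d L C_τ β_τ 1`).
PER MEMBER both statements are THEOREMS (`B9Thm311InvAtHIWitnessCubeZd.invAtHI_withGopZdH_opsAllZd_cube`, `B9Thm33GlobalBlockWitnessCubeZd.globAtI_
withGopZdH_opsAllZd_cube`); UNIFORMLY they are print's Theorem 3.11 and Theorem 3.3 for the cube family — N06's content proper, NOT proved.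

WHAT IS DEFINED ∕ PROVED (2 def + 4 thm; no `sorry`, no `instance`, no `notation`).
* §1 ★ `InvAtHICubeUniform`, ★ `GlobAtICubeUniform` (the two uniform datum-keyed statements), `invAtHICubeUniform_anti`, `globAtICubeUniform_anti`.
* §2 ★★★ `sockB9P3D4β_cube_uniform_of` — `InvAtHICubeUniform τ L ops₀ aI` + `GlobAtICubeUniform τ L ops₀ aT B₀` (`0 < B₀`) ⟹ for every `M ≥ 1`, every cube
  member (`2 ≤ L ≤ ρ`, `m ≤ k`): `SockB9P3D4β L B₀′ ((20d+2)B₀′) cP i.η m i.Ω i.Λs (cubeLamBP …)` with `B₀′ = max{1, 2B₀max{1,q}}`,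
  `cP = min{1∕16, min aI aT, 1∕(2B₀·14(d−1)·M+1)}` — ONE constant set for the whole family; ★ `exists_member_witness` (A6: at each member the two
  statements' member instances hold — by FILE 4 ∕ FILE 7 — so the hypotheses are consistent member by member).

HONEST SCOPE.  Two definitions + a by-name reduction; the uniform statements are NOT proved (= Thm 3.11 ∕ Thm 3.3 for the cube family); count-neutral
helper of K1⁸ (`--supports stmt-QuantumFields-26907`); N05∕N06 NOT discharged; one finite `𝕋⁴` programme at fixed `ε`, Bałaban as printed; R4 closes only
the conditional finite-`𝕋⁴` rung `BalabanLadder.UV` — nothing continuum ∕ `ℝ⁴` ∕ OS ∕ mass gap ∕ Clay.  Unit `pub-ymgap-dag-n06-b` (g20), 2026-08-28.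
-/

noncomputable section

open scoped BigOperators
open NormedSpace

namespace Literature.MathematicalPhysics.QuantumFieldTheory.Balaban1983to89.B9SupplySockB9P3ZdCubeUniform

open B7Prop2Explicit (unitaryUnits)
open B8Eq131Cubes (cube sqLo sqHi)
open B8Eq131CubesAdmissible (cubeFam)
open B8CubeMemberZd (cubeLamS)
open B8Ineq159FlatCubeMemberPrinted (cubeLamBP)
open B8LeafModelZd (ZdIdx)
open B9SupplySockB9P3ZdLetters (OpsZd)
open B9SupplySockB9P3ZdLettersOmega (Margin2 margin2_cubeFam)
open B9SupplySockB9P3ZdBeta (SockB9P3D4β)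
open B9SupplySockB9P3ZdGamma (SeesDom seesDom_cubeLamBP)
open B9Eq327GreenZdHerm (withGopZdH)
open B9Eq316AveragingTransposeZd (qQ betaTau)
open B9Eq316AveragingTransposeZdLevelZero (avgAtγ_opsAllZd_cubeLamBP)
open B9SupplySockB9P3ZdAllLettersZd (opsAllZd curvAtInAk_opsAllZd)
open B9SupplySockB9P3ZdAtHermInAk (InvAtHI invAtHI_anti)
open B9SupplySockB9P3ZdDatum (GlobAtI globAtI_anti sockB9P3D4βU_at)
open B9Thm311InvAtHIWitnessCubeZd (invAtHI_withGopZdH_opsAllZd_cube curvAtInAk_withGopZdH_iff avgAtγ_withGopZdH_iff)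
open B9Thm33GlobalBlockWitnessCubeZd (landauAtU_withGopZdH_opsAllZd globAtI_withGopZdH_opsAllZd_cube)
open B9Thm311PosDefOpenZd (cubeMember_Ω0_finite)

export B7Prop1Explicit (Site)

variable {d : ℕ} {𝔸 : Type*} [CStarAlgebra 𝔸] [FiniteDimensional ℝ 𝔸] (τ : 𝔸 →ₗ[ℂ] ℂ) (L : ℕ)

/-! ## §1 The two member-uniform statements the cube road needs from N06 -/

section Uniform

/-- ★ **THEOREM 3.11 FOR THE CUBE FAMILY IN THE DATUM'S CURRENCY, UNIFORM** («there exist constants M₀, α₀′ such that …»): ONE threshold `aI` such that at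
EVERY cube member of [B8] (1.131) (`Ω = cubeFam false L a Mc ρ k`, `Λs = cubeLamS …`, `L ≤ ρ`), every truncation `m ≤ k` and every block parameter `M`,
the (3.27) binder `InvAtHI` holds for the genuine record `withGopZdH (opsAllZd τ L (cubeLamBP …) ops₀)`.  A `Prop` — NOT proved (per member it is
`B9Thm311InvAtHIWitnessCubeZd.invAtHI_withGopZdH_opsAllZd_cube`). [cite: Balaban1985BackgroundPropagators, Thm 3.11 p.416, (3.27) p.395; Balaban1985RegularSpaces, (1.58) p.86, (1.131) p.99, (1.33) p.82] -/
def InvAtHICubeUniform (ops₀ : ℝ → ZdIdx d L → ℕ → OpsZd d 𝔸) (aI : ℝ) : Prop :=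
  ∀ (M : ℝ) (i : ZdIdx d L) (a : Site d) (Mc ρ : ℕ) (m : ℕ), L ≤ ρ → i.Ω = cubeFam false L a Mc ρ i.k → i.Λs = cubeLamS L a Mc ρ i.k → m ≤ i.k →
    InvAtHI L (withGopZdH (opsAllZd τ L (cubeLamBP L a Mc ρ i.k) ops₀)) aI M i m

/-- ★ **THEOREM 3.3's GLOBAL (3.47) BLOCK FOR THE CUBE FAMILY IN THE DATUM'S CURRENCY, UNIFORM** («constants … depending on d and L only»): ONE threshold `aT`
and ONE constant `B₀` such that at EVERY cube member, every `m ≤ k`, every `M`, `GlobAtI` holds for the genuine record.  A `Prop` — NOT proved (per member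
it is `B9Thm33GlobalBlockWitnessCubeZd.globAtI_withGopZdH_opsAllZd_cube`). [cite: Balaban1985BackgroundPropagators, Thm 3.3 p.399, (3.47) p.398; Balaban1985RegularSpaces, (1.59) p.86, (1.131) p.99] -/
def GlobAtICubeUniform (ops₀ : ℝ → ZdIdx d L → ℕ → OpsZd d 𝔸) (aT B₀ : ℝ) : Prop :=
  ∀ (M : ℝ) (i : ZdIdx d L) (a : Site d) (Mc ρ : ℕ) (m : ℕ), L ≤ ρ → i.Ω = cubeFam false L a Mc ρ i.k → i.Λs = cubeLamS L a Mc ρ i.k → m ≤ i.k →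
    GlobAtI L (withGopZdH (opsAllZd τ L (cubeLamBP L a Mc ρ i.k) ops₀)) aT B₀ M i m

variable {τ L}

/-- antitone in the threshold. [cite: Balaban1985BackgroundPropagators, Thm 3.11 p.416 (bookkeeping)] -/
theorem invAtHICubeUniform_anti {ops₀ : ℝ → ZdIdx d L → ℕ → OpsZd d 𝔸} {aI aI' : ℝ} (h : aI' ≤ aI) (hI : InvAtHICubeUniform τ L ops₀ aI) :
    InvAtHICubeUniform τ L ops₀ aI' :=
  fun M i a Mc ρ m hρ hΩ hΛs hm => invAtHI_anti L h (hI M i a Mc ρ m hρ hΩ hΛs hm)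

/-- antitone in the threshold, monotone in the constant. [cite: Balaban1985BackgroundPropagators, Thm 3.3 p.399 (bookkeeping)] -/
theorem globAtICubeUniform_anti {ops₀ : ℝ → ZdIdx d L → ℕ → OpsZd d 𝔸} {aT aT' B₀ B₀' : ℝ} (ha : aT' ≤ aT) (hB : B₀ ≤ B₀')
    (hG : GlobAtICubeUniform τ L ops₀ aT B₀) : GlobAtICubeUniform τ L ops₀ aT' B₀' :=
  fun M i a Mc ρ m hρ hΩ hΛs hm => globAtI_anti L ha hB (hG M i a Mc ρ m hρ hΩ hΛs hm)

end Uniform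

/-! ## §2 The β collar socket at every cube member with ONE constant set -/

section Socket

variable [Nontrivial 𝔸]
  (hτp : ∀ a : 𝔸, a ≠ 0 → 0 < (τ (star a * a)).re) (hτt : ∀ a b : 𝔸, τ (a * b) = τ (b * a))
  (hτs : ∀ a : 𝔸, τ (star a) = starRingEnd ℂ (τ a))

include hτp hτt hτs in
/-- ★★★ **THE CUBE ROAD'S JUNCTION, UNIFORM FORM**: the two member-uniform statements `InvAtHICubeUniform τ L ops₀ aI` (Thm 3.11) and `GlobAtICubeUniform τ L
ops₀ aT B₀` (Thm 3.3's (3.47) block), `0 < B₀`, give at EVERY cube member (`2 ≤ d`, `2 ≤ L ≤ ρ`, `m ≤ k`), every `M ≥ 1`, the β collar socket of [B8] (1.59)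
for the genuine record with ONE constant set: `SockB9P3D4β L B₀′ ((20d+2)B₀′) cP i.η m i.Ω i.Λs (cubeLamBP …)`, `B₀′ = max{1, 2B₀max{1,q}}`,
`q = qQ d L C_τ β_τ 1`, `cP = min{1∕16, min aI aT, 1∕(2B₀·14(d−1)·M+1)}` — the remaining three binders of the frame-free supplier being member-free theorems
(`curvAtInAk_opsAllZd`, `landauAtU_withGopZdH_opsAllZd`, `avgAtγ_opsAllZd_cubeLamBP`).  This is the shape [B8]'s Theorem-4 driver consumes (uniform in
the cube); what N06 owes the cube road is exactly the two hypotheses. [cite: Balaban1985RegularSpaces, (1.58)–(1.59) p.86, Thm 4 p.88, (1.131) p.99; Balaban1985BackgroundPropagators, Thm 3.3 p.399, Thm 3.11 p.416, (3.47) p.398, (3.27) p.395] -/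
theorem sockB9P3D4β_cube_uniform_of [NeZero L] (hd2 : 2 ≤ d) (hL : 2 ≤ L)
    {Cτ : ℝ} (hCτ : ∀ x y : 𝔸, |(τ (star x * y)).re| ≤ Cτ * ‖x‖ * ‖y‖)
    (ops₀ : ℝ → ZdIdx d L → ℕ → OpsZd d 𝔸) {aI aT B₀ : ℝ} (hB₀ : 0 < B₀)
    (hI : InvAtHICubeUniform τ L ops₀ aI) (hG : GlobAtICubeUniform τ L ops₀ aT B₀)
    {M : ℝ} (hM1 : 1 ≤ M) (i : ZdIdx d L) {a : Site d} {Mc ρ : ℕ} (hρ : L ≤ ρ)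
    (hΩ : i.Ω = cubeFam false L a Mc ρ i.k) (hΛs : i.Λs = cubeLamS L a Mc ρ i.k) {m : ℕ} (hm : m ≤ i.k) :
    SockB9P3D4β (𝔸 := 𝔸) L (max 1 (2 * B₀ * max 1 (qQ d L Cτ (betaTau τ) 1)))
      ((20 * d + 2) * max 1 (2 * B₀ * max 1 (qQ d L Cτ (betaTau τ) 1)))
      (min (1 / 16) (min (min aI aT) (1 / (2 * B₀ * (14 * ((d - 1 : ℕ) : ℝ)) * M + 1))))
      i.η m i.Ω i.Λs (cubeLamBP L a Mc ρ i.k) := by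
  have hL1 : 1 ≤ L := le_trans (by norm_num) hL
  have hfin : (i.Ω 0).Finite := cubeMember_Ω0_finite i hΩ
  have hMi : Margin2 i.Ω := by rw [hΩ]; exact margin2_cubeFam L a Mc (le_trans hL hρ) i.k
  have hsee : SeesDom L m (i.Ω 0) (cubeLamBP L a Mc ρ i.k) := by rw [hΩ]; exact seesDom_cubeLamBP hL1 a Mc hρ hm
  have hq : 0 ≤ qQ d L Cτ (betaTau τ) 1 := by
    have hCτ0 : 0 ≤ Cτ := by
      have h := hCτ 1 1
      rw [star_one, one_mul, norm_one, mul_one, mul_one] at h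
      exact le_trans (abs_nonneg _) h
    have hβ : 0 ≤ betaTau τ := by
      unfold betaTau
      split_ifs
      · exact Finset.sum_nonneg fun i _ => mul_nonneg (norm_nonneg _) (norm_nonneg _)
      · exact le_rfl
    have hα : 0 ≤ B9Eq316AveragingTransposeZd.alphaQ d L := (B9Eq316AveragingTransposeZd.alphaQ_pos d hL1).le
    have hθ : 0 ≤ B7Prop5GeneralLevels.thetaGen d L (B9Eq316AveragingTransposeZd.alphaQ d L) := by
      unfold B7Prop5GeneralLevels.thetaGen; positivity
    unfold qQ; positivity
  exact sockB9P3D4βU_at L (withGopZdH (opsAllZd τ L (cubeLamBP L a Mc ρ i.k) ops₀)) hd2 hL1 hM1 i hMi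
    (invAtHI_anti L (min_le_left _ _) (hI M i a Mc ρ m hρ hΩ hΛs hm))
    ((curvAtInAk_withGopZdH_iff _ M i m _).mpr (curvAtInAk_opsAllZd τ L (cubeLamBP L a Mc ρ i.k) ops₀ hL1 hM1 i m))
    (landauAtU_withGopZdH_opsAllZd τ hτp hτt hτs (cubeLamBP L a Mc ρ i.k) ops₀ M i m hfin)
    (cubeLamBP L a Mc ρ i.k)
    ((avgAtγ_withGopZdH_iff _ M i m _ _).mpr (avgAtγ_opsAllZd_cubeLamBP τ hd2 hL hCτ ops₀ M i hρ hΩ hm))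
    hsee (globAtI_anti L (min_le_right _ _) le_rfl (hG M i a Mc ρ m hρ hΩ hΛs hm)) (by positivity) hq hB₀

include hτp hτt hτs in
/-- ★ **A6 — THE MEMBER INSTANCES OF THE TWO UNIFORM STATEMENTS HOLD** (so the hypotheses of `sockB9P3D4β_cube_uniform_of` are consistent member by member; what
is open is only the uniformity of `(aI, aT, B₀)` in the member). [cite: Balaban1985BackgroundPropagators, Thm 3.3 p.399, Thm 3.11 p.416; Balaban1985RegularSpaces, (1.131) p.99] -/
theorem exists_member_witness (hd2 : 2 ≤ d) (hL : 2 ≤ L)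
    {Cτ : ℝ} (hCτ : ∀ x y : 𝔸, |(τ (star x * y)).re| ≤ Cτ * ‖x‖ * ‖y‖)
    (ops₀ : ℝ → ZdIdx d L → ℕ → OpsZd d 𝔸) (M : ℝ) (i : ZdIdx d L) {a : Site d} {Mc ρ : ℕ} (hρ : L ≤ ρ)
    (hΩ : i.Ω = cubeFam false L a Mc ρ i.k) (hΛs : i.Λs = cubeLamS L a Mc ρ i.k) {m : ℕ} (hm : m ≤ i.k) :
    (∃ aI : ℝ, 0 < aI ∧ InvAtHI L (withGopZdH (opsAllZd τ L (cubeLamBP L a Mc ρ i.k) ops₀)) aI M i m) ∧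
      ∃ aT : ℝ, 0 < aT ∧ ∃ B₀ : ℝ, 0 < B₀ ∧ GlobAtI L (withGopZdH (opsAllZd τ L (cubeLamBP L a Mc ρ i.k) ops₀)) aT B₀ M i m :=
  ⟨invAtHI_withGopZdH_opsAllZd_cube τ hτp hτt hτs hd2 hL ops₀ M i hρ hΩ hΛs hm,
    globAtI_withGopZdH_opsAllZd_cube τ hτp hτt hτs hd2 hL hCτ ops₀ M i hρ hΩ hΛs hm⟩

end Socket

end Literature.MathematicalPhysics.QuantumFieldTheory.Balaban1983to89.B9SupplySockB9P3ZdCubeUniform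

end
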